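import Literature.MathematicalPhysics.QuantumLattice.KomaTasakiSSB
import HarnessLib

/-!
# Long-range order ⟹ order under a symmetry-breaking field: the Kaplan–Horsch–von der Linden
# inequality in finite volume with explicit constant (Koma–Tasaki 1993, Theorem 7.1 and eq. (7.10))

Seat `hubbard-cq-lit-1` (cell `pub/hubbard-cq`, LADDER-Hubbard rows CQ / PC: the finite-field,
finite-volume parents of the «pinning-field response» and «energy-kink» certificate candidates
PC-a / PC-c are priced against this statement).  Sources, read at the locators:

* T. Koma, H. Tasaki, *Symmetry breaking in Heisenberg antiferromagnets*, Commun. Math. Phys.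
  **158** (1993) 191–214 (`KomaTasaki1993`, held as `paper:doi-10-1007-bf02097237`), §7
  "Symmetry breaking in ground states", Theorem 7.1 and its proof (7.4)–(7.10), pp. 209–210.
* T. A. Kaplan, P. Horsch, W. von der Linden, *Order parameter in quantum antiferromagnets*,
  J. Phys. Soc. Jpn. **58** (1989) 3894–3898 (`KaplanHorschVonDerLinden1989`; paywalled, cite-only
  `acq-04756`).  KT93 Theorem 7.1 IS this theorem and KT93 pp. 209–210 "first reproduce the proof of
  Theorem 7.1 [11]" — the secondary, re-proving source formalised here; both are cited.
* H. Tasaki, J. Stat. Phys. **174** (2019) 735–761 = arXiv:1807.05847 (`Tasaki2019Tower`), Theorem 2.1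
  ("Kaplan–Horsch–von der Linden theorem") with the same two-line variational proof and the remark
  "Note that the order of the limits is essential, since one obviously has
  `lim_{h↓0} ⟨Φ^{gs,h}_L| O_L/L^d |Φ^{gs,h}_L⟩ = 0` by continuity"; Theorem 3.5 (general class).

## The printed statement (KT93 Theorem 7.1, p. 209)

Setting of KT93 §2: finite lattice `Λ`, `N = |Λ|`, `𝓗_Λ = ⊗_x 𝓗_x` finite-dimensional,
`H_Λ = Σ_x h_x`, order operator `O_Λ = Σ_x o_x` (self-adjoint `h_x`, `o_x`), and
ii) `‖h_x‖ ≤ h̄`, `‖o_x‖ ≤ ō`; iii) `[h_x, o_y] = 0` unless `y ∈ S(x)`, `|S(x)| ≤ r`;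
`H_Λ(B) := H_Λ − B O_Λ` (2.6).  Let `Φ_Λ` and `Φ_Λ(B)` be ground states of `H_Λ` and `H_Λ(B)`;
i') `U_Λ Φ_Λ = Φ_Λ` for the unitary `U_Λ` of (2.3)/(2.5) (`U H U* = H`, `U O U* = −O`); the
long-range order parameter of the ground states is
`σ := lim_{Λ↑ℤ^d} N⁻¹ √(Φ_Λ, (O_Λ)² Φ_Λ)` (7.1) (a subsequence if necessary).

**Theorem 7.1 (Kaplan, Horsch and von der Linden).**  Under i'), ii), iii):
`liminf_{B↓0} liminf_{Λ↑ℤ^d} N⁻¹ (Φ_Λ(B), O_Λ Φ_Λ(B)) ≥ σ`.                              (7.2)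

The volume limit is taken FIRST, then `B ↓ 0`.  The proof prints the finite-`(B, N)` inequality:
with the trial state `Ψ_Λ = (Φ_Λ + O_ΛΦ_Λ/‖O_ΛΦ_Λ‖)/√2` (7.6),
`(Ψ_Λ, O_Λ Ψ_Λ) = √(Φ_Λ, O_Λ² Φ_Λ) =: σ_Λ N` (7.7)–(7.8) (the odd moments `(Φ_Λ, O_Λ^l Φ_Λ)`,
`l = 1, 3`, vanish by i')), `(Ψ_Λ, H_Λ Ψ_Λ) − E₀ = (Φ_Λ, [O_Λ,[H_Λ,O_Λ]] Φ_Λ)/(4(Φ_Λ,O_Λ²Φ_Λ)) = O(N⁻¹)`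
(7.9) (Horsch–von der Linden), the variational principle (7.4) and the sandwich
`B (Φ_Λ(B), O_Λ Φ_Λ(B)) ≥ B (Ψ_Λ, O_Λ Ψ_Λ) − {(Ψ_Λ, H_Λ Ψ_Λ) − E₀}` (7.5), whence
`N⁻¹ (Φ_Λ(B), O_Λ Φ_Λ(B)) ≥ σ_Λ − O(N⁻¹)/(B N)` (7.10), "By first letting `N ↑ ∞` and then
`B ↓ 0` … we get the desired inequality (7.2)".

## What this file proves (sorry-free; no named facts)

Abstract part (any complex inner-product space `E`, bounded `H`, `O`, a unit eigenvector `Φ` of `H`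
with `⟨Φ, OΦ⟩ = 0 = ⟨Φ, O³Φ⟩`, `OΦ ≠ 0`; `Ψ' := OΦ/‖OΦ‖`, `Ψ := (Φ + Ψ')/√2 = khvdlState`):
* `norm_khvdlState` (‖Ψ‖ = 1), `re_inner_khvdlState_hamiltonian`
  (`Re⟨Ψ,HΨ⟩ = (E₀ + Re⟨Ψ',HΨ'⟩)/2`), `re_inner_khvdlState_order` (`Re⟨Ψ,OΨ⟩ = ‖OΦ‖`, KT93
  (7.7)), `re_inner_khvdlState_field` (`Re⟨Ψ,(H − B·O)Ψ⟩ = (E₀ + Re⟨Ψ',HΨ'⟩)/2 − B‖OΦ‖`);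
* `khvdl_order_ge` — KT93 (7.5)/(7.10) in abstract form: if `E₀` is the ground-state energy of `H`
  and `Φ_B` is any variational ground state of `H − B·O`, `B > 0`, then
  `Re⟨Φ_B, O Φ_B⟩ ≥ ‖OΦ‖ − (Re⟨Ψ',HΨ'⟩ − E₀)/(2B)`;
* `inner_order_eq_zero_of_symmetry`, `inner_order_cube_eq_zero_of_symmetry` — hypothesis i')
  (`U` a linear isometry with `U O = −O U`, `UΦ = Φ`) gives the two vanishing odd moments used.
Lattice part (the explicit-hypotheses setting of `KomaTasaki.horschVonDerLinden`: `H = Σ h_x`,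
`O = Σ o_x`, `[o_x,o_y] = 0`, `[h_x,o_y] = 0` off `S_x`, `|S_x| ≤ r`, `‖h_x‖ ≤ h̄`, `‖o_x‖ ≤ ō`,
`0 < ō`, `Φ` a normalised ground state of `H` with `⟨Φ,OΦ⟩ = 0`, `⟨Φ,O²Φ⟩ ≥ (μōN)²`,
`0 < μ ≤ 1`, plus `⟨Φ,O³Φ⟩ = 0`), with the tree's PROVED Horsch–von der Linden constant
`c₀ = 2r²h̄μ⁻²` (`horschVonDerLinden_holds`, KT94 Thm 2.2):
* `kaplanHorschVonDerLinden_energy` — KT93 (7.4)+(7.7)+(7.9), the ENERGY-KINK form: the unit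
  vector `Ψ` has `Re⟨Ψ, (H − B·O) Ψ⟩ ≤ E₀ + c₀/(2N) − B ‖OΦ‖` for every real `B`
  (so every ground-state energy `E_Λ(B)` of `H − B·O` obeys `E_Λ(B) ≤ E_Λ(0) − B σ_Λ N + c₀/(2N)`);
* `kaplanHorschVonDerLinden_order` — KT93 (7.10): for `B > 0` and any variational ground state
  `Φ_B` of `H − B·O`, `Re⟨Φ_B, O Φ_B⟩ ≥ ‖OΦ‖ − c₀/(2BN)`, where `‖OΦ‖ = √⟨Φ,O²Φ⟩ ≥ μōN`;
* `kaplanHorschVonDerLinden_order_density` — per site: `N⁻¹ Re⟨Φ_B, O Φ_B⟩ ≥ μō − r²h̄/(μ²BN²)`;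
* `kaplanHorschVonDerLinden_limit` — the printed double limit (7.2) in `ε`–`N₀` form, uniform
  over all systems with the constants `(r, h̄, μ, ō)`: `∀ B > 0, ∀ ε > 0, ∃ N₀, N ≥ N₀ →
  N⁻¹ Re⟨Φ_B, O Φ_B⟩ ≥ μō − ε` (hence `liminf_{B↓0} liminf_N ≥ μō`; with `μō = σ_Λ` this is (7.2)).

Direction.  Every inequality here runs LRO ⟹ response (one-point order under the field, energy
kink).  The converse — order under an infinitesimal field, or a kink of `E_Λ(B)`, implying
long-range order of the `B = 0` ground states — is not a theorem of KHvdL/KT (KT94 §2.5: only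
`μ₁ ≥ μ₂`; Lieb–Seiringer–Yngvason 2007 §3) and is recorded as the barrier
`Literature.Barriers.HubbardSuperconductivity.SourcedOrderWithoutGroundStateLRO`.  At fixed finite
volume (7.10) is vacuous for `B ≲ c₀/(σ_Λ N²)` (Tasaki's continuity remark).

## Mathlib / tree search

`lean search 'kaplanHorsch|khvdl|hvdlState'`: nothing.  Reused: `KomaTasaki.horschVonDerLinden_holds`
(KT94 Thm 2.2 = KT93 (7.9) with `c₀ = 2r²h̄μ⁻²`).  Related tree items (not restated):
`HeisenbergNeelGapBound` (model-sharp HvdL constant for the HAF), `GroundStateSourceBounds`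
(Hellmann–Feynman sandwich for `Matrix.groundStateFunctional`, the (7.5) step in matrix language),
`DWaveSource.dWaveOrderParameter` (KT §1 sourced order parameter, `liminf_h liminf_L`),
`KomaTasakiSSBOrderParameter.theorem_2_5_orderOne*` (KT93 (7.25)–(7.26) = KT94 (2.30), the
`√2`/`√3` trial states of KT93 Thm 7.3 / Cor 7.2 — their field transfer is not in this file).
Mathlib: `norm_add_sq`, `inner_smul_left/right`, `LinearIsometry.inner_map_map`.
-/

noncomputable section

open Complex Finset Filter
open scoped InnerProductSpace ComplexConjugate Topology

namespace Literature.MathematicalPhysics.QuantumLattice.KomaTasaki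

universe u v

/-! ### Abstract part: the Kaplan–Horsch–von der Linden trial state -/

section Abstract

variable {E : Type v} [NormedAddCommGroup E] [InnerProductSpace ℂ E]

/-- The Horsch–von der Linden state `Ψ' = O Φ / ‖O Φ‖` (KT93 (7.6) second summand; KT94 (2.8)).
Junk (`0`) if `O Φ = 0`. [cite: KomaTasaki1993, §7 (7.6)] -/
def hvdlState (O : E →L[ℂ] E) (Φ : E) : E := (‖O Φ‖⁻¹ : ℂ) • O Φ

/-- The Kaplan–Horsch–von der Linden trial state `Ψ = (Φ + O Φ/‖O Φ‖)/√2` (KT93 (7.6);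
Tasaki 2019 `Ξ⁺_L`). [cite: KomaTasaki1993, §7 (7.6)] [cite: KaplanHorschVonDerLinden1989, main construction] -/
def khvdlState (O : E →L[ℂ] E) (Φ : E) : E :=
  ((Real.sqrt 2)⁻¹ : ℂ) • (Φ + hvdlState O Φ)

/-- Unfolding lemma. [cite: KomaTasaki1993, §7 (7.6)] -/
theorem hvdlState_def (O : E →L[ℂ] E) (Φ : E) : hvdlState O Φ = (‖O Φ‖⁻¹ : ℂ) • O Φ := rfl

/-- Unfolding lemma. [cite: KomaTasaki1993, §7 (7.6)] -/
theorem khvdlState_def (O : E →L[ℂ] E) (Φ : E) :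
    khvdlState O Φ = ((Real.sqrt 2)⁻¹ : ℂ) • (Φ + hvdlState O Φ) := rfl

/-- `‖O Φ / ‖O Φ‖‖ = 1` when `O Φ ≠ 0` (the Horsch–von der Linden state is normalised, KT94 (2.8);
KT93 (7.6)). [cite: KomaTasaki1994, Theorem 2.2 (2.8)] [cite: KomaTasaki1993, §7 (7.6)] -/
theorem norm_hvdlState {O : E →L[ℂ] E} {Φ : E} (hne : O Φ ≠ 0) : ‖hvdlState O Φ‖ = 1 := by
  have hpos : 0 < ‖O Φ‖ := norm_pos_iff.mpr hne
  rw [hvdlState_def, norm_smul, norm_inv, Complex.norm_real, Real.norm_eq_abs,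
    abs_of_pos hpos, inv_mul_cancel₀ hpos.ne']

/-- `⟨Φ, O Φ⟩ = 0` makes `Φ ⊥ O Φ/‖O Φ‖` (KT93 p. 210: the two summands of (7.6) are orthogonal by
i'); KT94 (2.6) ⇒ `Ψ ⊥ Φ`). [cite: KomaTasaki1993, §7 (7.6)–(7.7)] [cite: KomaTasaki1994, Theorem 2.2 (2.6)] -/
theorem inner_hvdlState_eq_zero {O : E →L[ℂ] E} {Φ : E} (hOΦ : ⟪Φ, O Φ⟫_ℂ = 0) :
    ⟪Φ, hvdlState O Φ⟫_ℂ = 0 := by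
  rw [hvdlState_def, inner_smul_right, hOΦ, mul_zero]

/-- The scalar `(√2)⁻¹` is real: `conj c = c`. [folklore] -/
private theorem conj_sqrt_two_inv : conj ((Real.sqrt 2)⁻¹ : ℂ) = ((Real.sqrt 2)⁻¹ : ℂ) := by
  rw [map_inv₀, Complex.conj_ofReal]

/-- `(√2)⁻¹ · (√2)⁻¹ = 1/2` in `ℂ`. [folklore] -/
private theorem sqrt_two_inv_mul_self :
    ((Real.sqrt 2)⁻¹ : ℂ) * ((Real.sqrt 2)⁻¹ : ℂ) = (2 : ℂ)⁻¹ := by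
  rw [← mul_inv, ← Complex.ofReal_mul, Real.mul_self_sqrt (by norm_num : (0 : ℝ) ≤ 2)]
  norm_num

/-- **`‖Ψ‖ = 1`** for the KHvdL state, given `‖Φ‖ = 1`, `⟨Φ, OΦ⟩ = 0`, `OΦ ≠ 0`
(KT93 after (7.23): "Since the states in the sum … are orthogonal to each other, the state is
normalized"). [cite: KomaTasaki1993, §7 (7.6)] -/
theorem norm_khvdlState {O : E →L[ℂ] E} {Φ : E} (hΦ : ‖Φ‖ = 1) (hOΦ : ⟪Φ, O Φ⟫_ℂ = 0)
    (hne : O Φ ≠ 0) : ‖khvdlState O Φ‖ = 1 := by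
  have h1 : ‖hvdlState O Φ‖ = 1 := norm_hvdlState hne
  have h0 : ⟪Φ, hvdlState O Φ⟫_ℂ = 0 := inner_hvdlState_eq_zero hOΦ
  have hsq : ‖Φ + hvdlState O Φ‖ ^ 2 = 2 := by
    rw [@norm_add_sq ℂ, hΦ, h1, h0]
    simp; norm_num
  have hsum : ‖Φ + hvdlState O Φ‖ = Real.sqrt 2 := by
    rw [← Real.sqrt_sq (norm_nonneg _), hsq]
  have hs : 0 < Real.sqrt 2 := Real.sqrt_pos.mpr (by norm_num)
  rw [khvdlState_def, norm_smul, norm_inv, Complex.norm_real, Real.norm_eq_abs, abs_of_pos hs,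
    hsum, inv_mul_cancel₀ hs.ne']

/-- **Energy of the KHvdL state**: `Re⟨Ψ, HΨ⟩ = (E₀ + Re⟨Ψ', HΨ'⟩)/2` for a symmetric `H` with
`HΦ = E₀Φ`, `‖Φ‖ = 1`, `⟨Φ, OΦ⟩ = 0` (the cross terms vanish: KT93 (7.9) first line).
[cite: KomaTasaki1993, §7 (7.9)] -/
theorem re_inner_khvdlState_hamiltonian {H O : E →L[ℂ] E} {Φ : E} {E₀ : ℝ}
    (hH : ∀ φ ψ : E, ⟪H φ, ψ⟫_ℂ = ⟪φ, H ψ⟫_ℂ) (hΦ : ‖Φ‖ = 1) (hHΦ : H Φ = (E₀ : ℂ) • Φ)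
    (hOΦ : ⟪Φ, O Φ⟫_ℂ = 0) :
    (⟪khvdlState O Φ, H (khvdlState O Φ)⟫_ℂ).re =
      (E₀ + (⟪hvdlState O Φ, H (hvdlState O Φ)⟫_ℂ).re) / 2 := by
  set Ψ' := hvdlState O Φ with hΨ'
  have h0 : ⟪Φ, Ψ'⟫_ℂ = 0 := inner_hvdlState_eq_zero hOΦ
  have h0' : ⟪Ψ', Φ⟫_ℂ = 0 := by rw [← inner_conj_symm, h0, map_zero]
  have hΦΦ : ⟪Φ, Φ⟫_ℂ = 1 := by
    rw [inner_self_eq_norm_sq_to_K, hΦ]; norm_num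
  -- the four matrix elements
  have h11 : ⟪Φ, H Φ⟫_ℂ = (E₀ : ℂ) := by rw [hHΦ, inner_smul_right, hΦΦ, mul_one]
  have h21 : ⟪Ψ', H Φ⟫_ℂ = 0 := by rw [hHΦ, inner_smul_right, h0', mul_zero]
  have h12 : ⟪Φ, H Ψ'⟫_ℂ = 0 := by rw [← hH, hHΦ, inner_smul_left, h0, mul_zero]
  have hexp : ⟪khvdlState O Φ, H (khvdlState O Φ)⟫_ℂ =
      (2 : ℂ)⁻¹ * ((E₀ : ℂ) + ⟪Ψ', H Ψ'⟫_ℂ) := by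
    rw [khvdlState_def, map_smul, inner_smul_left, inner_smul_right, conj_sqrt_two_inv,
      ← mul_assoc, sqrt_two_inv_mul_self, map_add, inner_add_left, inner_add_right,
      inner_add_right, h11, h12, h21, add_zero, zero_add]
  rw [hexp]
  have h2 : ((2 : ℂ)⁻¹ * ((E₀ : ℂ) + ⟪Ψ', H Ψ'⟫_ℂ)).re = (E₀ + (⟪Ψ', H Ψ'⟫_ℂ).re) / 2 := by
    have : (2 : ℂ)⁻¹ = ((2⁻¹ : ℝ) : ℂ) := by norm_num
    rw [this, Complex.re_ofReal_mul, Complex.add_re, Complex.ofReal_re]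
    ring
  exact h2

/-- **Order parameter of the KHvdL state** (KT93 (7.7)–(7.8)):
`Re⟨Ψ, OΨ⟩ = √⟨Φ, O²Φ⟩ = ‖OΦ‖` for a symmetric `O` with `⟨Φ, OΦ⟩ = 0 = ⟨Φ, O³Φ⟩`, `OΦ ≠ 0`.
[cite: KomaTasaki1993, §7 (7.7)–(7.8)] -/
theorem re_inner_khvdlState_order {O : E →L[ℂ] E} {Φ : E}
    (hO : ∀ φ ψ : E, ⟪O φ, ψ⟫_ℂ = ⟪φ, O ψ⟫_ℂ) (hOΦ : ⟪Φ, O Φ⟫_ℂ = 0)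
    (hO3 : ⟪Φ, O (O (O Φ))⟫_ℂ = 0) (hne : O Φ ≠ 0) :
    (⟪khvdlState O Φ, O (khvdlState O Φ)⟫_ℂ).re = ‖O Φ‖ := by
  have hpos : 0 < ‖O Φ‖ := norm_pos_iff.mpr hne
  set a : ℂ := (‖O Φ‖⁻¹ : ℂ) with ha
  have haconj : conj a = a := by rw [ha, map_inv₀, Complex.conj_ofReal]
  have hOO : ⟪O Φ, O Φ⟫_ℂ = ((‖O Φ‖ ^ 2 : ℝ) : ℂ) := by
    rw [inner_self_eq_norm_sq_to_K]; norm_cast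
  -- the four matrix elements of `O` between `Φ` and `Ψ' = a • OΦ`
  have h12 : ⟪Φ, O (hvdlState O Φ)⟫_ℂ = a * ⟪O Φ, O Φ⟫_ℂ := by
    rw [hvdlState_def, map_smul, inner_smul_right, ← hO]
  have h21 : ⟪hvdlState O Φ, O Φ⟫_ℂ = a * ⟪O Φ, O Φ⟫_ℂ := by
    rw [hvdlState_def, inner_smul_left, haconj]
  have h22 : ⟪hvdlState O Φ, O (hvdlState O Φ)⟫_ℂ = 0 := by
    rw [hvdlState_def, map_smul, inner_smul_left, inner_smul_right, hO, hO3, mul_zero,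
      mul_zero]
  have hexp : ⟪khvdlState O Φ, O (khvdlState O Φ)⟫_ℂ = (2 : ℂ)⁻¹ * (2 * (a * ⟪O Φ, O Φ⟫_ℂ)) := by
    rw [khvdlState_def, map_smul, inner_smul_left, inner_smul_right, conj_sqrt_two_inv,
      ← mul_assoc, sqrt_two_inv_mul_self, map_add, inner_add_left, inner_add_right,
      inner_add_right, hOΦ, h12, h21, h22, zero_add, add_zero, two_mul]
  rw [hexp, ← mul_assoc, inv_mul_cancel₀ (two_ne_zero), one_mul, hOO, ha, ← Complex.ofReal_inv,
    ← Complex.ofReal_mul, Complex.ofReal_re, sq, ← mul_assoc, inv_mul_cancel₀ hpos.ne', one_mul]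

/-- **The KHvdL state under the field Hamiltonian `H − B·O`** (KT93 (7.4) with (7.7), (7.9)):
`Re⟨Ψ, (H − B·O)Ψ⟩ = (E₀ + Re⟨Ψ', HΨ'⟩)/2 − B ‖OΦ‖` for every real `B`.
[cite: KomaTasaki1993, §7 (7.4)–(7.9)] -/
theorem re_inner_khvdlState_field {H O : E →L[ℂ] E} {Φ : E} {E₀ : ℝ}
    (hH : ∀ φ ψ : E, ⟪H φ, ψ⟫_ℂ = ⟪φ, H ψ⟫_ℂ) (hO : ∀ φ ψ : E, ⟪O φ, ψ⟫_ℂ = ⟪φ, O ψ⟫_ℂ)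
    (hΦ : ‖Φ‖ = 1) (hHΦ : H Φ = (E₀ : ℂ) • Φ) (hOΦ : ⟪Φ, O Φ⟫_ℂ = 0)
    (hO3 : ⟪Φ, O (O (O Φ))⟫_ℂ = 0) (hne : O Φ ≠ 0) (B : ℝ) :
    (⟪khvdlState O Φ, (H - (B : ℂ) • O) (khvdlState O Φ)⟫_ℂ).re =
      (E₀ + (⟪hvdlState O Φ, H (hvdlState O Φ)⟫_ℂ).re) / 2 - B * ‖O Φ‖ := by
  rw [FunLike.coe_sub, Pi.sub_apply, FunLike.coe_smul, Pi.smul_apply,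
    inner_sub_right, inner_smul_right, Complex.sub_re, Complex.re_ofReal_mul,
    re_inner_khvdlState_hamiltonian hH hΦ hHΦ hOΦ, re_inner_khvdlState_order hO hOΦ hO3 hne]

/-- **KT93 (7.5) ⟹ (7.10), abstract form.**  Let `E₀` be the ground-state energy of the symmetric
`H` (`HΦ = E₀Φ`, `‖Φ‖ = 1`, and `E₀ ≤ Re⟨ψ,Hψ⟩` for all unit `ψ`), `O` symmetric with
`⟨Φ,OΦ⟩ = 0 = ⟨Φ,O³Φ⟩`, `OΦ ≠ 0`, and let `Φ_B` (`‖Φ_B‖ = 1`) minimise `Re⟨ψ,(H − B·O)ψ⟩` over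
unit vectors (a ground state of `H(B) = H − B O`, `B > 0`).  Then
`Re⟨Φ_B, O Φ_B⟩ ≥ ‖OΦ‖ − (Re⟨Ψ',HΨ'⟩ − E₀)/(2B)`, `Ψ' = OΦ/‖OΦ‖`
("`±(Φ_Λ(B),O_ΛΦ_Λ(B)) ≥ (Ψ_Λ,O_ΛΨ_Λ) − B⁻¹{(Ψ_Λ,H_ΛΨ_Λ) − E₀}`", (7.5)).
[cite: KomaTasaki1993, Theorem 7.1, proof (7.4)–(7.5), (7.10)] [cite: KaplanHorschVonDerLinden1989, main theorem] -/
theorem khvdl_order_ge {H O : E →L[ℂ] E} {Φ : E} {E₀ : ℝ}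
    (hH : ∀ φ ψ : E, ⟪H φ, ψ⟫_ℂ = ⟪φ, H ψ⟫_ℂ) (hO : ∀ φ ψ : E, ⟪O φ, ψ⟫_ℂ = ⟪φ, O ψ⟫_ℂ)
    (hΦ : ‖Φ‖ = 1) (hHΦ : H Φ = (E₀ : ℂ) • Φ)
    (hground : ∀ ψ : E, ‖ψ‖ = 1 → E₀ ≤ (⟪ψ, H ψ⟫_ℂ).re)
    (hOΦ : ⟪Φ, O Φ⟫_ℂ = 0) (hO3 : ⟪Φ, O (O (O Φ))⟫_ℂ = 0) (hne : O Φ ≠ 0)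
    {B : ℝ} (hB : 0 < B) {ΦB : E} (hΦB : ‖ΦB‖ = 1)
    (hmin : ∀ ψ : E, ‖ψ‖ = 1 →
      (⟪ΦB, (H - (B : ℂ) • O) ΦB⟫_ℂ).re ≤ (⟪ψ, (H - (B : ℂ) • O) ψ⟫_ℂ).re) :
    ‖O Φ‖ - ((⟪hvdlState O Φ, H (hvdlState O Φ)⟫_ℂ).re - E₀) / (2 * B) ≤ (⟪ΦB, O ΦB⟫_ℂ).re := by
  set δ : ℝ := (⟪hvdlState O Φ, H (hvdlState O Φ)⟫_ℂ).re with hδ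
  -- (7.4): the ground state of `H(B)` lies below the trial state
  have h1 := hmin (khvdlState O Φ) (norm_khvdlState hΦ hOΦ hne)
  rw [re_inner_khvdlState_field hH hO hΦ hHΦ hOΦ hO3 hne B] at h1
  -- expand `⟨Φ_B, (H - B O) Φ_B⟩`
  have h2 : (⟪ΦB, (H - (B : ℂ) • O) ΦB⟫_ℂ).re = (⟪ΦB, H ΦB⟫_ℂ).re - B * (⟪ΦB, O ΦB⟫_ℂ).re := by
    rw [FunLike.coe_sub, Pi.sub_apply, FunLike.coe_smul, Pi.smul_apply,
      inner_sub_right, inner_smul_right, Complex.sub_re, Complex.re_ofReal_mul]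
  -- `E₀ ≤ ⟨Φ_B, H Φ_B⟩`
  have h3 := hground ΦB hΦB
  have key : B * ‖O Φ‖ - (δ - E₀) / 2 ≤ B * (⟪ΦB, O ΦB⟫_ℂ).re := by linarith
  have key' : B * (‖O Φ‖ - (δ - E₀) / (2 * B)) ≤ B * (⟪ΦB, O ΦB⟫_ℂ).re := by
    calc B * (‖O Φ‖ - (δ - E₀) / (2 * B)) = B * ‖O Φ‖ - (δ - E₀) / 2 := by
          field_simp
      _ ≤ B * (⟪ΦB, O ΦB⟫_ℂ).re := key
  exact le_of_mul_le_mul_left key' hB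

/-- **Hypothesis i') gives the vanishing first moment**: if `U` is a linear isometry with
`U (O v) = −O (U v)` for all `v` (KT93 (2.5), `U O U* = −O`) and `U Φ = Φ` (i')), then
`⟨Φ, OΦ⟩ = 0` (KT93 p. 210: "(Φ_Λ, (O_Λ)^l Φ_Λ) = 0 for any positive odd integer l").
[cite: KomaTasaki1993, §7 i') and (7.7)] -/
theorem inner_order_eq_zero_of_symmetry {O : E →L[ℂ] E} {Φ : E} (U : E →ₗᵢ[ℂ] E)
    (hUO : ∀ v : E, U (O v) = -O (U v)) (hUΦ : U Φ = Φ) : ⟪Φ, O Φ⟫_ℂ = 0 := by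
  have h : ⟪Φ, O Φ⟫_ℂ = -⟪Φ, O Φ⟫_ℂ := by
    calc ⟪Φ, O Φ⟫_ℂ = ⟪U Φ, U (O Φ)⟫_ℂ := (U.inner_map_map Φ (O Φ)).symm
      _ = -⟪Φ, O Φ⟫_ℂ := by rw [hUO, hUΦ, inner_neg_right]
  have h2 : (2 : ℂ) * ⟪Φ, O Φ⟫_ℂ = 0 := by rw [two_mul]; nth_rw 2 [h]; exact add_neg_cancel _
  simpa using h2

/-- **Hypothesis i') gives the vanishing third moment** `⟨Φ, O³Φ⟩ = 0` (same symmetry argument,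
`U O³ = −O³ U`). [cite: KomaTasaki1993, §7 i') and (7.7)] -/
theorem inner_order_cube_eq_zero_of_symmetry {O : E →L[ℂ] E} {Φ : E} (U : E →ₗᵢ[ℂ] E)
    (hUO : ∀ v : E, U (O v) = -O (U v)) (hUΦ : U Φ = Φ) : ⟪Φ, O (O (O Φ))⟫_ℂ = 0 := by
  have hU3 : U (O (O (O Φ))) = -O (O (O Φ)) := by
    rw [hUO, hUO, hUO, hUΦ, map_neg, map_neg, neg_neg, map_neg]
  have h : ⟪Φ, O (O (O Φ))⟫_ℂ = -⟪Φ, O (O (O Φ))⟫_ℂ := by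
    calc ⟪Φ, O (O (O Φ))⟫_ℂ = ⟪U Φ, U (O (O (O Φ)))⟫_ℂ := (U.inner_map_map _ _).symm
      _ = -⟪Φ, O (O (O Φ))⟫_ℂ := by rw [hU3, hUΦ, inner_neg_right]
  have h2 : (2 : ℂ) * ⟪Φ, O (O (O Φ))⟫_ℂ = 0 := by
    rw [two_mul]; nth_rw 2 [h]; exact add_neg_cancel _
  simpa using h2

end Abstract

/-! ### Lattice part: KT93 Theorem 7.1 with the Horsch–von der Linden constant `c₀ = 2r²h̄μ⁻²` -/

section Lattice

variable {Λ : Type u} [Fintype Λ] [Nonempty Λ] {E : Type v} [NormedAddCommGroup E]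
  [InnerProductSpace ℂ E] [FiniteDimensional ℂ E]

omit [FiniteDimensional ℂ E] in
/-- From `⟨Φ, O²Φ⟩ ≥ (μōN)²` (KT (2.17)/(7.8)) and symmetry of `O`: `‖OΦ‖ ≥ μōN`
(with `μ, ō ≥ 0`). [cite: KomaTasaki1993, §7 (7.8)] -/
theorem norm_order_apply_ge {O : E →L[ℂ] E} {Φ : E} {μ obar : ℝ} (hμ : 0 ≤ μ) (hob : 0 ≤ obar)
    (hO : ∀ φ ψ : E, ⟪O φ, ψ⟫_ℂ = ⟪φ, O ψ⟫_ℂ)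
    (hlro : (μ * obar * Fintype.card Λ) ^ 2 ≤ (⟪Φ, O (O Φ)⟫_ℂ).re) :
    μ * obar * Fintype.card Λ ≤ ‖O Φ‖ := by
  have hsq : (⟪Φ, O (O Φ)⟫_ℂ).re = ‖O Φ‖ ^ 2 := by
    rw [← hO, inner_self_eq_norm_sq_to_K]; norm_cast
  rw [hsq] at hlro
  have h0 : 0 ≤ μ * obar * Fintype.card Λ := by positivity
  exact (sq_le_sq₀ h0 (norm_nonneg _)).mp hlro

/-- **KT93 Theorem 7.1, energy form (the Kaplan–Horsch–von der Linden energy bound; (7.4) with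
(7.7) and (7.9)).**  In the setting of `horschVonDerLinden` (`H = Σ h_x`, `O = Σ o_x`,
`[o_x,o_y] = 0`, `[h_x,o_y] = 0` unless `y ∈ S_x`, `|S_x| ≤ r`, `‖h_x‖ ≤ h̄`, `‖o_x‖ ≤ ō`, `ō > 0`;
`Φ` a normalised eigenvector of `H` with eigenvalue `E`, `⟨Φ,OΦ⟩ = 0`, `⟨Φ,O²Φ⟩ ≥ (μōN)²`,
`0 < μ ≤ 1`) and with `⟨Φ,O³Φ⟩ = 0` (i')), the KHvdL trial state `Ψ = (Φ + OΦ/‖OΦ‖)/√2` is a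
unit vector with
`Re⟨Ψ, (H − B·O) Ψ⟩ ≤ E + c₀/(2N) − B·‖OΦ‖` for every real `B`, `c₀ = 2r²h̄μ⁻²`, `‖OΦ‖ ≥ μōN`.
Hence every ground-state energy of `H − B·O` is `≤ E − B√⟨Φ,O²Φ⟩ + r²h̄/(μ²N)`: long-range order
forces a kink of slope `≥ σ_Λ N` in the ground-state energy as a function of the field, up to
`O(N⁻¹)`. [cite: KomaTasaki1993, Theorem 7.1, proof (7.4), (7.7), (7.9)] [cite: KaplanHorschVonDerLinden1989, main theorem] -/
theorem kaplanHorschVonDerLinden_energy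
    (h o : Λ → E →L[ℂ] E) (supp : Λ → Finset Λ) (r : ℕ) (hbar obar μ : ℝ) (Φ : E) (EΛ : ℝ)
    (hhsym : ∀ x, (h x : E →ₗ[ℂ] E).IsSymmetric) (hosym : ∀ x, (o x : E →ₗ[ℂ] E).IsSymmetric)
    (hhb : ∀ x, ‖h x‖ ≤ hbar) (hob : ∀ x, ‖o x‖ ≤ obar) (hobpos : 0 < obar)
    (hoo : ∀ x y, Commute (o x) (o y)) (hho : ∀ x y, y ∉ supp x → Commute (h x) (o y))
    (hsupp : ∀ x, (supp x).card ≤ r)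
    (hΦ1 : ‖Φ‖ = 1) (hHΦ : (∑ x, h x) Φ = (EΛ : ℂ) • Φ)
    (hOΦ : ⟪Φ, (∑ x, o x) Φ⟫_ℂ = 0) (hμ : 0 < μ) (hμ1 : μ ≤ 1)
    (hlro : (μ * obar * Fintype.card Λ) ^ 2 ≤ (⟪Φ, (∑ x, o x) ((∑ x, o x) Φ)⟫_ℂ).re)
    (hO3 : ⟪Φ, (∑ x, o x) ((∑ x, o x) ((∑ x, o x) Φ))⟫_ℂ = 0) :
    ‖khvdlState (∑ x, o x) Φ‖ = 1 ∧
      μ * obar * Fintype.card Λ ≤ ‖(∑ x, o x) Φ‖ ∧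
      ∀ B : ℝ,
        (⟪khvdlState (∑ x, o x) Φ,
            ((∑ x, h x) - (B : ℂ) • (∑ x, o x)) (khvdlState (∑ x, o x) Φ)⟫_ℂ).re ≤
          EΛ + (2 * (r : ℝ) ^ 2 * hbar / μ ^ 2) / Fintype.card Λ / 2 - B * ‖(∑ x, o x) Φ‖ := by
  obtain ⟨hne, hbound⟩ := horschVonDerLinden_holds h o supp r hbar obar μ Φ EΛ hhsym hosym hhb
    hob hobpos hoo hho hsupp hΦ1 hHΦ hOΦ hμ hμ1 hlro
  set O : E →L[ℂ] E := ∑ x, o x with hOdef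
  set H : E →L[ℂ] E := ∑ x, h x with hHdef
  have hOsym : ∀ φ ψ : E, ⟪O φ, ψ⟫_ℂ = ⟪φ, O ψ⟫_ℂ := by
    intro φ ψ
    simp only [hOdef, FunLike.coe_sum, Finset.sum_apply, sum_inner, inner_sum]
    exact Finset.sum_congr rfl fun x _ => hosym x φ ψ
  have hHsym : ∀ φ ψ : E, ⟪H φ, ψ⟫_ℂ = ⟪φ, H ψ⟫_ℂ := by
    intro φ ψ
    simp only [hHdef, FunLike.coe_sum, Finset.sum_apply, sum_inner, inner_sum]
    exact Finset.sum_congr rfl fun x _ => hhsym x φ ψ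
  refine ⟨norm_khvdlState hΦ1 hOΦ hne,
    norm_order_apply_ge hμ.le hobpos.le hOsym hlro, fun B => ?_⟩
  rw [re_inner_khvdlState_field hHsym hOsym hΦ1 hHΦ hOΦ hO3 hne B]
  have hδ : (⟪hvdlState O Φ, H (hvdlState O Φ)⟫_ℂ).re ≤
      EΛ + (2 * (r : ℝ) ^ 2 * hbar / μ ^ 2) / Fintype.card Λ := by
    have := (abs_le.mp hbound).2
    rw [hvdlState_def]
    linarith
  linarith

/-- **KT93 Theorem 7.1, finite-volume order-parameter form = eq. (7.10) (Kaplan–Horsch–von der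
Linden 1989).**  Same setting; let moreover `E` be the ground-state energy of `H`
(`E ≤ Re⟨ψ,Hψ⟩` for unit `ψ`), `B > 0`, and `Φ_B` any unit vector minimising `Re⟨ψ,(H − B·O)ψ⟩`
(a ground state of `H_Λ(B) = H_Λ − B O_Λ`, KT93 (2.6)).  Then
`Re⟨Φ_B, O Φ_B⟩ ≥ ‖OΦ‖ − c₀/(2BN)`, `c₀ = 2r²h̄μ⁻²`, where `‖OΦ‖ = √⟨Φ,O²Φ⟩ ≥ μōN`
— KT93 (7.10): "`N⁻¹(Φ_Λ(B),O_ΛΦ_Λ(B)) ≥ σ_Λ − O(N⁻¹)/(BN)`; by first letting `N ↑ ∞` and then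
`B ↓ 0` … we get the desired inequality (7.2)".
[cite: KomaTasaki1993, Theorem 7.1, eq. (7.10)] [cite: KaplanHorschVonDerLinden1989, main theorem] -/
theorem kaplanHorschVonDerLinden_order
    (h o : Λ → E →L[ℂ] E) (supp : Λ → Finset Λ) (r : ℕ) (hbar obar μ : ℝ) (Φ : E) (EΛ : ℝ)
    (hhsym : ∀ x, (h x : E →ₗ[ℂ] E).IsSymmetric) (hosym : ∀ x, (o x : E →ₗ[ℂ] E).IsSymmetric)
    (hhb : ∀ x, ‖h x‖ ≤ hbar) (hob : ∀ x, ‖o x‖ ≤ obar) (hobpos : 0 < obar)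
    (hoo : ∀ x y, Commute (o x) (o y)) (hho : ∀ x y, y ∉ supp x → Commute (h x) (o y))
    (hsupp : ∀ x, (supp x).card ≤ r)
    (hΦ1 : ‖Φ‖ = 1) (hHΦ : (∑ x, h x) Φ = (EΛ : ℂ) • Φ)
    (hground : ∀ ψ : E, ‖ψ‖ = 1 → EΛ ≤ (⟪ψ, (∑ x, h x) ψ⟫_ℂ).re)
    (hOΦ : ⟪Φ, (∑ x, o x) Φ⟫_ℂ = 0) (hμ : 0 < μ) (hμ1 : μ ≤ 1)
    (hlro : (μ * obar * Fintype.card Λ) ^ 2 ≤ (⟪Φ, (∑ x, o x) ((∑ x, o x) Φ)⟫_ℂ).re)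
    (hO3 : ⟪Φ, (∑ x, o x) ((∑ x, o x) ((∑ x, o x) Φ))⟫_ℂ = 0)
    {B : ℝ} (hB : 0 < B) {ΦB : E} (hΦB : ‖ΦB‖ = 1)
    (hmin : ∀ ψ : E, ‖ψ‖ = 1 →
      (⟪ΦB, ((∑ x, h x) - (B : ℂ) • (∑ x, o x)) ΦB⟫_ℂ).re ≤
        (⟪ψ, ((∑ x, h x) - (B : ℂ) • (∑ x, o x)) ψ⟫_ℂ).re) :
    μ * obar * Fintype.card Λ ≤ ‖(∑ x, o x) Φ‖ ∧
      ‖(∑ x, o x) Φ‖ - (2 * (r : ℝ) ^ 2 * hbar / μ ^ 2) / Fintype.card Λ / (2 * B) ≤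
        (⟪ΦB, (∑ x, o x) ΦB⟫_ℂ).re := by
  obtain ⟨hne, hbound⟩ := horschVonDerLinden_holds h o supp r hbar obar μ Φ EΛ hhsym hosym hhb
    hob hobpos hoo hho hsupp hΦ1 hHΦ hOΦ hμ hμ1 hlro
  set O : E →L[ℂ] E := ∑ x, o x with hOdef
  set H : E →L[ℂ] E := ∑ x, h x with hHdef
  have hOsym : ∀ φ ψ : E, ⟪O φ, ψ⟫_ℂ = ⟪φ, O ψ⟫_ℂ := by
    intro φ ψ
    simp only [hOdef, FunLike.coe_sum, Finset.sum_apply, sum_inner, inner_sum]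
    exact Finset.sum_congr rfl fun x _ => hosym x φ ψ
  have hHsym : ∀ φ ψ : E, ⟪H φ, ψ⟫_ℂ = ⟪φ, H ψ⟫_ℂ := by
    intro φ ψ
    simp only [hHdef, FunLike.coe_sum, Finset.sum_apply, sum_inner, inner_sum]
    exact Finset.sum_congr rfl fun x _ => hhsym x φ ψ
  refine ⟨norm_order_apply_ge hμ.le hobpos.le hOsym hlro, ?_⟩
  have hk := khvdl_order_ge hHsym hOsym hΦ1 hHΦ hground hOΦ hO3 hne hB hΦB hmin
  -- `(Re⟨Ψ',HΨ'⟩ − E) ≤ |Re⟨Ψ',HΨ'⟩ − E| ≤ c₀/N`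
  have hδ : ((⟪hvdlState O Φ, H (hvdlState O Φ)⟫_ℂ).re - EΛ) / (2 * B) ≤
      (2 * (r : ℝ) ^ 2 * hbar / μ ^ 2) / Fintype.card Λ / (2 * B) := by
    apply div_le_div_of_nonneg_right _ (by positivity)
    have := (abs_le.mp hbound).2
    rw [hvdlState_def]
    linarith
  linarith

/-- **KT93 Theorem 7.1 per site.**  Same hypotheses: the sourced order parameter per site obeys
`N⁻¹ Re⟨Φ_B, O Φ_B⟩ ≥ μō − r²h̄/(μ² B N²)` — the finite-size correction to the long-range-order
floor `μō` is `O(1/(B N²))`, i.e. vacuous for `B ≲ r²h̄/(μ³ō N²)` and negligible for fixed `B > 0`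
as `N → ∞` (KT93 (7.10)). [cite: KomaTasaki1993, Theorem 7.1, eq. (7.10)] [cite: KaplanHorschVonDerLinden1989, main theorem] -/
theorem kaplanHorschVonDerLinden_order_density
    (h o : Λ → E →L[ℂ] E) (supp : Λ → Finset Λ) (r : ℕ) (hbar obar μ : ℝ) (Φ : E) (EΛ : ℝ)
    (hhsym : ∀ x, (h x : E →ₗ[ℂ] E).IsSymmetric) (hosym : ∀ x, (o x : E →ₗ[ℂ] E).IsSymmetric)
    (hhb : ∀ x, ‖h x‖ ≤ hbar) (hob : ∀ x, ‖o x‖ ≤ obar) (hobpos : 0 < obar)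
    (hoo : ∀ x y, Commute (o x) (o y)) (hho : ∀ x y, y ∉ supp x → Commute (h x) (o y))
    (hsupp : ∀ x, (supp x).card ≤ r)
    (hΦ1 : ‖Φ‖ = 1) (hHΦ : (∑ x, h x) Φ = (EΛ : ℂ) • Φ)
    (hground : ∀ ψ : E, ‖ψ‖ = 1 → EΛ ≤ (⟪ψ, (∑ x, h x) ψ⟫_ℂ).re)
    (hOΦ : ⟪Φ, (∑ x, o x) Φ⟫_ℂ = 0) (hμ : 0 < μ) (hμ1 : μ ≤ 1)
    (hlro : (μ * obar * Fintype.card Λ) ^ 2 ≤ (⟪Φ, (∑ x, o x) ((∑ x, o x) Φ)⟫_ℂ).re)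
    (hO3 : ⟪Φ, (∑ x, o x) ((∑ x, o x) ((∑ x, o x) Φ))⟫_ℂ = 0)
    {B : ℝ} (hB : 0 < B) {ΦB : E} (hΦB : ‖ΦB‖ = 1)
    (hmin : ∀ ψ : E, ‖ψ‖ = 1 →
      (⟪ΦB, ((∑ x, h x) - (B : ℂ) • (∑ x, o x)) ΦB⟫_ℂ).re ≤
        (⟪ψ, ((∑ x, h x) - (B : ℂ) • (∑ x, o x)) ψ⟫_ℂ).re) :
    μ * obar - (r : ℝ) ^ 2 * hbar / μ ^ 2 / (B * (Fintype.card Λ : ℝ) ^ 2) ≤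
      (⟪ΦB, (∑ x, o x) ΦB⟫_ℂ).re / Fintype.card Λ := by
  obtain ⟨hfloor, hk⟩ := kaplanHorschVonDerLinden_order h o supp r hbar obar μ Φ EΛ hhsym hosym
    hhb hob hobpos hoo hho hsupp hΦ1 hHΦ hground hOΦ hμ hμ1 hlro hO3 hB hΦB hmin
  have hN : (0 : ℝ) < Fintype.card Λ := Nat.cast_pos.mpr Fintype.card_pos
  rw [le_div_iff₀ hN]
  have halg : (μ * obar - (r : ℝ) ^ 2 * hbar / μ ^ 2 / (B * (Fintype.card Λ : ℝ) ^ 2)) *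
      Fintype.card Λ =
      μ * obar * Fintype.card Λ -
        (2 * (r : ℝ) ^ 2 * hbar / μ ^ 2) / Fintype.card Λ / (2 * B) := by
    field_simp
  rw [halg]
  linarith

/-- **KT93 Theorem 7.1 as printed, (7.2): `liminf_{B↓0} liminf_{Λ↑ℤ^d} N⁻¹(Φ_Λ(B),O_ΛΦ_Λ(B)) ≥ σ`,
in `ε`–`N₀` form.**  For every field `B > 0` and `ε > 0` there is `N₀` (depending only on
`r, h̄, μ, B, ε`) such that for EVERY system of the above class on a lattice with `N ≥ N₀` sites and
every ground state `Φ_B` of `H − B·O`: `N⁻¹ Re⟨Φ_B, O Φ_B⟩ ≥ μō − ε`.  (Taking `μō = σ_Λ`, the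
long-range order parameter itself, and `N → ∞` then `B ↓ 0` gives (7.2); the volume limit is taken
first — at fixed `N` the bound degenerates as `B ↓ 0`.)
[cite: KomaTasaki1993, Theorem 7.1 (7.2)] [cite: KaplanHorschVonDerLinden1989, main theorem] [cite: Tasaki2019Tower, Theorems 2.1 and 3.5] -/
theorem kaplanHorschVonDerLinden_limit (r : ℕ) (hbar μ : ℝ) (hμ : 0 < μ) {B ε : ℝ} (hB : 0 < B)
    (hε : 0 < ε) :
    ∃ N₀ : ℕ, ∀ {Λ : Type u} [Fintype Λ] [Nonempty Λ] {E : Type v} [NormedAddCommGroup E]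
      [InnerProductSpace ℂ E] [FiniteDimensional ℂ E]
      (h o : Λ → E →L[ℂ] E) (supp : Λ → Finset Λ) (obar : ℝ) (Φ : E) (EΛ : ℝ),
      (∀ x, (h x : E →ₗ[ℂ] E).IsSymmetric) → (∀ x, (o x : E →ₗ[ℂ] E).IsSymmetric) →
      (∀ x, ‖h x‖ ≤ hbar) → (∀ x, ‖o x‖ ≤ obar) → 0 < obar →
      (∀ x y, Commute (o x) (o y)) → (∀ x y, y ∉ supp x → Commute (h x) (o y)) →
      (∀ x, (supp x).card ≤ r) →
      ‖Φ‖ = 1 → (∑ x, h x) Φ = (EΛ : ℂ) • Φ →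
      (∀ ψ : E, ‖ψ‖ = 1 → EΛ ≤ (⟪ψ, (∑ x, h x) ψ⟫_ℂ).re) →
      ⟪Φ, (∑ x, o x) Φ⟫_ℂ = 0 → μ ≤ 1 →
      (μ * obar * Fintype.card Λ) ^ 2 ≤ (⟪Φ, (∑ x, o x) ((∑ x, o x) Φ)⟫_ℂ).re →
      ⟪Φ, (∑ x, o x) ((∑ x, o x) ((∑ x, o x) Φ))⟫_ℂ = 0 →
      N₀ ≤ Fintype.card Λ →
      ∀ {ΦB : E}, ‖ΦB‖ = 1 →
        (∀ ψ : E, ‖ψ‖ = 1 →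
          (⟪ΦB, ((∑ x, h x) - (B : ℂ) • (∑ x, o x)) ΦB⟫_ℂ).re ≤
            (⟪ψ, ((∑ x, h x) - (B : ℂ) • (∑ x, o x)) ψ⟫_ℂ).re) →
        μ * obar - ε ≤ (⟪ΦB, (∑ x, o x) ΦB⟫_ℂ).re / Fintype.card Λ := by
  -- choose `N₀ ≥ 1` with `r² h̄ / (μ² B) ≤ ε N₀`; then `r²h̄/(μ²BN²) ≤ r²h̄/(μ²BN) ≤ ε` for `N ≥ N₀`
  obtain ⟨N₀, hN₀⟩ := exists_nat_ge (max 1 ((r : ℝ) ^ 2 * hbar / μ ^ 2 / B / ε))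
  refine ⟨N₀, ?_⟩
  intro Λ _ _ E _ _ _ h o supp obar Φ EΛ hhsym hosym hhb hob hobpos hoo hho hsupp hΦ1 hHΦ
    hground hOΦ hμ1 hlro hO3 hN ΦB hΦB hmin
  have hdens := kaplanHorschVonDerLinden_order_density h o supp r hbar obar μ Φ EΛ hhsym hosym
    hhb hob hobpos hoo hho hsupp hΦ1 hHΦ hground hOΦ hμ hμ1 hlro hO3 hB hΦB hmin
  have hN1 : (1 : ℝ) ≤ Fintype.card Λ := by
    have : (1 : ℝ) ≤ N₀ := le_trans (le_max_left _ _) hN₀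
    exact this.trans (by exact_mod_cast hN)
  have hNpos : (0 : ℝ) < Fintype.card Λ := by linarith
  -- the correction term is at most `ε`: `A/(B N²) = (A/B)/N² ≤ ε N/N² = ε/N ≤ ε`
  have hcorr : (r : ℝ) ^ 2 * hbar / μ ^ 2 / (B * (Fintype.card Λ : ℝ) ^ 2) ≤ ε := by
    have hK : (r : ℝ) ^ 2 * hbar / μ ^ 2 / B / ε ≤ Fintype.card Λ :=
      le_trans (le_trans (le_max_right _ _) hN₀) (by exact_mod_cast hN)
    have hK' : (r : ℝ) ^ 2 * hbar / μ ^ 2 / B ≤ ε * Fintype.card Λ := by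
      rw [div_le_iff₀ hε] at hK
      linarith
    rw [← div_div]
    calc (r : ℝ) ^ 2 * hbar / μ ^ 2 / B / (Fintype.card Λ : ℝ) ^ 2
        ≤ ε * Fintype.card Λ / (Fintype.card Λ : ℝ) ^ 2 :=
          div_le_div_of_nonneg_right hK' (by positivity)
      _ = ε / Fintype.card Λ := by rw [sq, ← div_div, mul_div_cancel_right₀ _ hNpos.ne']
      _ ≤ ε := div_le_self hε.le hN1
  linarith

end Lattice

end Literature.MathematicalPhysics.QuantumLattice.KomaTasaki
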